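/-
COR-CM (cell pub-hodgecm2 = stage 2 of the Hodge ladder), seat b26 gen 20 (prover-pub-hodgecm2-b26-g20-0, 2026-08-21);
count-neutral for the binder table (no row).  Lane CM-FIELD-POWERS, part 9 (capstone): the structure of `End⁰(X)` for
EVERY complex abelian variety, and for every complex abelian variety of CM-type.  Theorems only.
-/
import Summits.HodgeConjecture.CorCM.CMProductEndAlgebra
import Literature.AlgebraicGeometry.Motives.AbelianVarietyIsotypicDecomposition
import HarnessLib

/-!
# `End⁰(X) = ⊕ᵢ M_{nᵢ+1}(End⁰ Bᵢ)` for every complex abelian variety; the CM case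

D. Mumford, *Abelian Varieties* (1970), §19, Cor. 1 of Thm. 1 and p. 174: every abelian variety `X` is
isogenous to `X₁^{n₁} × ⋯ × X_k^{n_k}` with the `Xᵢ` simple and pairwise non-isogenous, and then
«`End⁰(X) = ⊕ᵢ M_{nᵢ}(Dᵢ)`, `Dᵢ = End⁰(Xᵢ)`».  G. Shimura, *Abelian Varieties with Complex Multiplication
and Modular Functions* (1998), §5.1 Props. 1, 3, 4, 6: in characteristic `0` a simple abelian variety of
CM-type has `End_Q(B) = K` a (CM) field of degree `2 dim B` (`g = 1`), so for `X` of CM-type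
`End⁰(X) = ⊕ᵢ M_{nᵢ}(Kᵢ)`.

This file ASSEMBLES the tree's pieces into unconditional statements for every complex abelian variety:
the isotypic decomposition (`Motives/AbelianVarietyIsotypicDecomposition`, Poincaré reducibility +
grouping), `End⁰` of an orthogonal biproduct (`Motives/AbelianVarietyEndAlgebraOrthogonalBiproduct`),
`End⁰(B^m) ≅ Mat_m(End⁰ B)` (`CorCM/EndAlgebraPowerMatrix`) and their combination
(`CorCM/CMProductEndAlgebra`):

* `isOfCMType_biproduct_fin_iff`, `isOfCMType_biproduct_powers_iff` — CM-type of `⨁_{Fin m} A i` /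
  `⨁ᵢ Bᵢ^{nᵢ+1}` is CM-type of all factors (from the tree's `isOfCMType_prod_iff`).
* `exists_endAlgebra_structure` — **every complex `X`**: `X ∼ ⨁ᵢ Bᵢ^{nᵢ+1}` (`Bᵢ` simple, `dim > 0`,
  pairwise non-isogenous), `dim_ℚ End⁰(X) = Σᵢ (nᵢ+1)² dim_ℚ End⁰(Bᵢ)`, and `End⁰(X)` is commutative iff
  all `nᵢ = 0` and all `End⁰(Bᵢ)` are commutative.
* `IsOfCMType.exists_endAlgebra_structure` — **every complex `X` of CM-type**: the same `Bᵢ` are of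
  CM-type with `End⁰(Bᵢ)` a field of degree `2 dim Bᵢ` (`Milne1999.IsOfCMTypeSimple`),
  `dim_ℚ End⁰(X) = Σᵢ (nᵢ+1)² · 2 dim Bᵢ`, `dim X = Σᵢ (nᵢ+1) dim Bᵢ`, and `End⁰(X)` is commutative iff
  all `nᵢ = 0` (iff `dim_ℚ End⁰(X) = 2 dim X`, cf. `ComplexMultiplication.endAlgebra_comm_iff_finrank_eq_of_isOfCMType`).

## References
* [MumfordAV1970] D. Mumford, *Abelian Varieties* (1970), §19 Thm. 1 Cor. 1–2 and p. 174.
* [Shimura1998] G. Shimura, *Abelian Varieties with Complex Multiplication and Modular Functions* (1998),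
  §5.1 Propositions 1, 3, 4, 6.
* [Milne1999] J. S. Milne, *Lefschetz motives and the Tate conjecture*, Compositio Math. 117 (1999), §2 p. 54.
-/

noncomputable section

open CategoryTheory CategoryTheory.Limits

namespace Summit.HodgeConjecture.CorCM.CMProductEnd

open Literature.AlgebraicGeometry.Motives Literature.AlgebraicGeometry.Motives.AbelianVariety
open Literature.AlgebraicGeometry.ComplexMultiplication
open Literature.AlgebraicGeometry.Milne1999 (IsOfCMType IsOfCMTypeSimple)
open Summit.HodgeConjecture.CorCM.AndreRiemann Summit.HodgeConjecture.CorCM.EndAlgebraPower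

/-! ## §1 CM-type of finite biproducts -/

/-- **`⨁_{Fin m} A i` is of CM-type iff every `A i` is** (the tree's `isOfCMType_prod_iff`, by
induction through `⨁_{Fin (m+1)} A ≅ A 0 × ⨁_{Fin m} (A ∘ succ)`, `AndreRiemann.biproduct_succ_split`;
the empty biproduct has dimension `0`). [cite: Milne1999, §2 p. 54] -/
theorem isOfCMType_biproduct_fin_iff : ∀ {m : ℕ} (A : Fin m → AbelianVariety ℂ),
    IsOfCMType (⨁ A) ↔ ∀ i, IsOfCMType (A i)
  | 0, A => by
    refine ⟨fun _ i => Fin.elim0 i, fun _ => ?_⟩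
    exact Literature.AlgebraicGeometry.Milne1999.isOfCMType_of_dim_eq_zero (dim_biproduct_fin_zero A)
  | m + 1, A => by
    obtain ⟨h, g, hhg, hgh⟩ := biproduct_succ_split A
    have hiso : IsIsogenous (⨁ A) ((A 0).prod (⨁ (A ∘ Fin.succ))) :=
      ⟨h, isIsogeny_hom_of_iso ⟨h, g, hhg, hgh⟩⟩
    rw [Literature.AlgebraicGeometry.Milne1999.isOfCMType_iff_of_isIsogenous hiso,
      Literature.AlgebraicGeometry.Milne1999.isOfCMType_prod_iff, isOfCMType_biproduct_fin_iff (A ∘ Fin.succ)]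
    constructor
    · rintro ⟨h0, hs⟩ i
      exact Fin.cases h0 (fun j => hs j) i
    · intro hall
      exact ⟨hall 0, fun j => hall j.succ⟩

/-- **`⨁ᵢ Bᵢ^{nᵢ+1}` is of CM-type iff every `Bᵢ` is.** [cite: Milne1999, §2 p. 54] -/
theorem isOfCMType_biproduct_powers_iff {r : ℕ} (B : Fin r → AbelianVariety ℂ) (n : Fin r → ℕ) :
    IsOfCMType (⨁ fun i => ⨁ fun _ : Fin (n i + 1) => B i) ↔ ∀ i, IsOfCMType (B i) := by
  rw [isOfCMType_biproduct_fin_iff]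
  refine forall_congr' fun i => ?_
  rw [isOfCMType_biproduct_fin_iff]
  exact ⟨fun h => h 0, fun h _ => h⟩

/-! ## §2 The structure of `End⁰(X)` for every complex abelian variety -/

/-- **Mumford §19 (Cor. 1 of Thm. 1 and p. 174) for every complex abelian variety `X`**: there are
simple, positive-dimensional, pairwise non-isogenous `B₀, …, B_{r-1}` and multiplicities with
`X ∼ ⨁ᵢ Bᵢ^{nᵢ+1}`; for any such data `dim_ℚ End⁰(X) = Σᵢ (nᵢ+1)² dim_ℚ End⁰(Bᵢ)`
(`End⁰(X) ≅ ⊕ᵢ M_{nᵢ+1}(End⁰ Bᵢ)`), and `End⁰(X)` is commutative iff all `nᵢ = 0` and all `End⁰(Bᵢ)`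
are commutative. [cite: MumfordAV1970, §19 Thm. 1 Cor. 1–2 and p. 174] -/
theorem exists_endAlgebra_structure (X : AbelianVariety ℂ) :
    ∃ (r : ℕ) (B : Fin r → AbelianVariety ℂ) (n : Fin r → ℕ),
      (∀ i, (B i).IsSimple) ∧ (∀ i, 0 < (B i).dim) ∧ (∀ i j, i ≠ j → ¬ IsIsogenous (B i) (B j)) ∧
      IsIsogenous X (⨁ fun i => ⨁ fun _ : Fin (n i + 1) => B i) ∧
      Module.finrank ℚ X.endAlgebra = ∑ i, (n i + 1) ^ 2 * Module.finrank ℚ (B i).endAlgebra ∧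
      ((∀ x y : X.endAlgebra, x * y = y * x) ↔
        (∀ i, n i = 0) ∧ ∀ i, ∀ x y : (B i).endAlgebra, x * y = y * x) := by
  obtain ⟨r, B, n, hS, hd, hni, hX⟩ := exists_isIsogenous_biproduct_powers_fin X
  have horth := orthogonal_of_isSimple_of_not_isIsogenous hS hni
  refine ⟨r, B, n, hS, hd, hni, hX, ?_, ?_⟩
  · rw [hX.finrank_endAlgebra_eq, finrank_endAlgebra_biproduct_powers horth]
  · rw [hX.endAlgebra_comm_iff, endAlgebra_biproduct_powers_comm_iff horth hd]

/-! ## §3 The structure of `End⁰(X)` for every complex abelian variety of CM-type -/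

/-- **Every complex abelian variety of CM-type is `∼ ⨁ᵢ Bᵢ^{nᵢ+1}` with `Bᵢ` simple CM
(`End⁰(Bᵢ)` a field of degree `2 dim Bᵢ`), pairwise non-isogenous; then
`dim_ℚ End⁰(X) = Σᵢ (nᵢ+1)² · 2 dim Bᵢ`, `dim X = Σᵢ (nᵢ+1) dim Bᵢ`, and `End⁰(X)` is commutative iff
all `nᵢ = 0` iff `dim_ℚ End⁰(X) = 2 dim X`** (Mumford §19 p. 174 with Shimura §5.1 Props. 4, 6:
`End⁰(X) = ⊕ᵢ M_{nᵢ+1}(Kᵢ)`, `Kᵢ` CM fields). [cite: MumfordAV1970, §19 Thm. 1 Cor. 1–2 and p. 174]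
[cite: Shimura1998, §5.1 Propositions 3, 4 and 6] [cite: Milne1999, §2 p. 54] -/
theorem IsOfCMType.exists_endAlgebra_structure {X : AbelianVariety ℂ} (hX : IsOfCMType X) :
    ∃ (r : ℕ) (B : Fin r → AbelianVariety ℂ) (n : Fin r → ℕ),
      (∀ i, (B i).IsSimple) ∧ (∀ i, IsOfCMTypeSimple (B i)) ∧
      (∀ i j, i ≠ j → ¬ IsIsogenous (B i) (B j)) ∧
      IsIsogenous X (⨁ fun i => ⨁ fun _ : Fin (n i + 1) => B i) ∧
      X.dim = ∑ i, (n i + 1) * (B i).dim ∧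
      Module.finrank ℚ X.endAlgebra = ∑ i, (n i + 1) ^ 2 * (2 * (B i).dim) ∧
      ((∀ x y : X.endAlgebra, x * y = y * x) ↔ ∀ i, n i = 0) ∧
      ((∀ x y : X.endAlgebra, x * y = y * x) ↔ Module.finrank ℚ X.endAlgebra = 2 * X.dim) := by
  obtain ⟨r, B, n, hS, hd, hni, hXT⟩ := exists_isIsogenous_biproduct_powers_fin X
  -- the factors are CM
  have hT : IsOfCMType (⨁ fun i => ⨁ fun _ : Fin (n i + 1) => B i) :=
    (Literature.AlgebraicGeometry.Milne1999.isOfCMType_iff_of_isIsogenous hXT).1 hX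
  have hBcm : ∀ i, IsOfCMTypeSimple (B i) := fun i =>
    (((isOfCMType_biproduct_powers_iff B n).1 hT) i).isOfCMTypeSimple (hS i) (hd i)
  refine ⟨r, B, n, hS, hBcm, hni, hXT, ?_, finrank_endAlgebra_of_isIsogenous_cmPowers hBcm hni hXT,
    endAlgebra_comm_iff_of_isIsogenous_cmPowers hBcm hni hXT,
    endAlgebra_comm_iff_finrank_eq_two_mul_dim hBcm hni hXT⟩
  obtain ⟨u, hu⟩ := hXT
  rw [dim_eq_of_isIsogeny hu, dim_biproduct_powers]

/-- **For a complex abelian variety of CM-type, `2 dim X ≤ dim_ℚ End⁰(X) ≤ …` — the multiplicity-one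
criterion**: `End⁰(X)` is a product of (CM) fields iff `X` is isogenous to a product of pairwise
non-isogenous simple CM abelian varieties, i.e. iff all multiplicities are one; in the decomposition of
`IsOfCMType.exists_endAlgebra_structure` this reads `∀ i, nᵢ = 0`.  Recorded as the special case:
`End⁰(X)` commutative ⟹ `X ∼ ⨁ᵢ Bᵢ` (no repeated factor). [cite: MumfordAV1970, §19 (p. 174)]
[cite: Shimura1998, §5.1 Propositions 3, 4 and 6] -/
theorem IsOfCMType.exists_isIsogenous_biproduct_simple_of_comm {X : AbelianVariety ℂ} (hX : IsOfCMType X)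
    (hcomm : ∀ x y : X.endAlgebra, x * y = y * x) :
    ∃ (r : ℕ) (B : Fin r → AbelianVariety ℂ),
      (∀ i, (B i).IsSimple) ∧ (∀ i, IsOfCMTypeSimple (B i)) ∧
      (∀ i j, i ≠ j → ¬ IsIsogenous (B i) (B j)) ∧
      IsIsogenous X (⨁ fun i => ⨁ fun _ : Fin (0 + 1) => B i) := by
  obtain ⟨r, B, n, hS, hBcm, hni, hXT, -, -, hcommiff, -⟩ := IsOfCMType.exists_endAlgebra_structure hX
  have hn : ∀ i, n i = 0 := hcommiff.1 hcomm
  have hn' : n = fun _ => 0 := funext hn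
  subst hn'
  exact ⟨r, B, hS, hBcm, hni, hXT⟩

end Summit.HodgeConjecture.CorCM.CMProductEnd

end
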